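import Summits.Parity.GeneralizedHardyLittlewood.Theorems.GreenTaoLevelTwoMNTwoCentralTranslation
import HarnessLib

/-!
# Route `GreenTaoLevelTwo`, crux `MNTwo` (stmt-Parity-21276), line `birth`: central frames for the
# vertical class (input of the vertical-reduction stub `stub_verticalReduction`)

A CENTRAL FRAME of a nilmanifold `Y = (G/Γ, d)` — the datum on which the vertical Fourier
expansion of Green–Tao 2012a Lemma 3.7 runs — is a continuous homomorphism `ι : (ℝ^I, +) → Z(G)`
ONTO the centre with `ι(ℤ^I) ⊆ Γ`, whose translations are uniformly Lipschitz on `(G/Γ, d)` and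
move points by at most `L ‖t‖`.  Definition-free, it is the proposition

`∃ I (Fintype I) ι L, 0 < L ∧ (ι (t+u) = ι t ι u) ∧ (ι t ∈ Z(G)) ∧ (Z(G) ⊆ range ι) ∧ (ι(ℤ^I) ⊆ Γ) ∧
  Continuous ι ∧ (∀ t p q, d(ι t · p, ι t · q) ≤ L d(p, q)) ∧ (∀ t p, d(ι t · p, p) ≤ L ‖t‖)`.

This file constructs central frames for the generators of the Heisenberg class (the re-metrised
Heisenberg nilmanifold `heisenbergWith d h` for a box-comparable Def-8.1 metric `d`, via the
central-translation bounds of `…MNTwoCentralTranslation`; the circle; the point) and shows they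
are inherited by `ofLE`, binary products (index set `I ⊕ J`, max metric) and powers; hence every
member of `𝒞₂(H_d)` and every `X^m × ℝ/ℤ` (`X ∈ 𝒞₂(H_d)`) — the nilmanifolds of the `MNTwo`
skeleton's stubs — carries a central frame (`centralFrame_verticalClass`).

References: B. Green, T. Tao, *The Möbius function is strongly orthogonal to nilsequences*,
Ann. of Math. 175 (2012), Lemma 3.7 [GreenTao2012Mobius]; B. Green, T. Tao, *Linear equations in
primes*, Ann. of Math. 171 (2010), Def. 8.1, §12 [GreenTao2010].
-/

noncomputable section

open Literature.NumberTheory.Sieve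
open Literature.NumberTheory.Sieve.GreenTaoLevelTwo (HX IsCompatMetric IsBoxComparable heisenbergWith
  InHeisClass boxGauge heisPreDist)
open Summit.Parity.GeneralizedHardyLittlewood.GreenTaoLevelTwoMNTwoCentralTranslation

namespace Summit.Parity.GeneralizedHardyLittlewood.GreenTaoLevelTwoMNTwoCentralFrames

/-! ### §1 Central frames of the generators -/

/-- **The re-metrised Heisenberg nilmanifold has a central frame** (rank `1`: `t ↦ (0,0,t)`;
constant `L² + L` from the box-comparability constant `L`). [cite: GreenTao2012Mobius, Lemma 3.7] -/
theorem centralFrame_heisenbergWith (d : HX → HX → ℝ) (h : IsCompatMetric d)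
    (hd : IsBoxComparable d) :
    ∃ (I : Type) (_ : Fintype I) (ι : (I → ℝ) → (heisenbergWith d h).G) (L : ℝ), 0 < L ∧
      (∀ t u, ι (t + u) = ι t * ι u) ∧
      (∀ t, ι t ∈ Subgroup.center (heisenbergWith d h).G) ∧
      (∀ z ∈ Subgroup.center (heisenbergWith d h).G, ∃ t, ι t = z) ∧
      (∀ n : I → ℤ, ι (fun i => (n i : ℝ)) ∈ (heisenbergWith d h).Γ) ∧
      Continuous ι ∧
      (∀ (t : I → ℝ) (p q : (heisenbergWith d h).G ⧸ (heisenbergWith d h).Γ),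
        (heisenbergWith d h).dist (ι t • p) (ι t • q) ≤ L * (heisenbergWith d h).dist p q) ∧
      (∀ (t : I → ℝ) (p : (heisenbergWith d h).G ⧸ (heisenbergWith d h).Γ),
        (heisenbergWith d h).dist (ι t • p) p ≤ L * ‖t‖) := by
  obtain ⟨L, hL0, hL⟩ := hd
  refine ⟨Fin 1, inferInstance, fun t => Heis.mk 0 0 (t 0), L ^ 2 + L, by positivity,
    fun t u => ?_, fun t => mk_zero_zero_mem_center _, fun z hz => ?_, fun n => ?_, ?_,
    fun t p q => ?_, fun t p => ?_⟩
  · simp only [Pi.add_apply]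
    exact mk_zero_zero_add _ _
  · obtain ⟨t, ht⟩ := exists_eq_mk_zero_zero_of_mem_center hz
    exact ⟨fun _ => t, ht⟩
  · exact mk_zero_zero_intCast_mem_latticeΓ (n 0)
  · exact continuous_mk_zero_zero.comp (continuous_apply 0)
  · -- the goal lives on `HX = H³(ℝ)/H³(ℤ)` with the metric `d` (definitional for `heisenbergWith`)
    have hmain := dist_center_smul_le hL0.le hL (mk_zero_zero_mem_center (t 0)) p q
    have hd0 : 0 ≤ d p q := (heisenbergWith d h).dist_nonneg p q
    have hLL : L ^ 2 ≤ L ^ 2 + L := by linarith [hL0.le]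
    exact hmain.trans (mul_le_mul_of_nonneg_right hLL hd0)
  · have hmain := dist_mk_zero_zero_smul_le hL0.le hL (t 0) p
    have ht : |t 0| ≤ ‖t‖ := by rw [← Real.norm_eq_abs]; exact norm_le_pi_norm t 0
    have hLL : L ≤ L ^ 2 + L := by nlinarith [hL0.le]
    refine hmain.trans ?_
    calc L * |t 0| ≤ L * ‖t‖ := mul_le_mul_of_nonneg_left ht hL0.le
      _ ≤ (L ^ 2 + L) * ‖t‖ := mul_le_mul_of_nonneg_right hLL (norm_nonneg _)

/-- **The circle has a central frame** (rank `1`: `t ↦ t`; constant `1`). [folklore] -/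
theorem centralFrame_circle :
    ∃ (I : Type) (_ : Fintype I) (ι : (I → ℝ) → Nilmanifold.circle.G) (L : ℝ), 0 < L ∧
      (∀ t u, ι (t + u) = ι t * ι u) ∧
      (∀ t, ι t ∈ Subgroup.center Nilmanifold.circle.G) ∧
      (∀ z ∈ Subgroup.center Nilmanifold.circle.G, ∃ t, ι t = z) ∧
      (∀ n : I → ℤ, ι (fun i => (n i : ℝ)) ∈ Nilmanifold.circle.Γ) ∧
      Continuous ι ∧
      (∀ (t : I → ℝ) (p q : Nilmanifold.circle.G ⧸ Nilmanifold.circle.Γ),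
        Nilmanifold.circle.dist (ι t • p) (ι t • q) ≤ L * Nilmanifold.circle.dist p q) ∧
      (∀ (t : I → ℝ) (p : Nilmanifold.circle.G ⧸ Nilmanifold.circle.Γ),
        Nilmanifold.circle.dist (ι t • p) p ≤ L * ‖t‖) := by
  refine ⟨Fin 1, inferInstance, fun t => Nilmanifold.circleElt (t 0), 1, one_pos,
    fun t u => ?_, fun t => ?_, fun z hz => ?_, fun n => ?_, ?_, fun t p q => ?_, fun t p => ?_⟩
  · simp only [Pi.add_apply]
    exact (Nilmanifold.circleElt_mul _ _).symm
  · rw [center_circle_eq_top]; exact Subgroup.mem_top _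
  · obtain ⟨t, ht⟩ := exists_eq_circleElt_of_mem_center hz
    exact ⟨fun _ => t, ht⟩
  · exact circleElt_intCast_mem_Γ (n 0)
  · exact continuous_circleElt.comp (continuous_apply 0)
  · rw [circle_dist_smul, one_mul]
  · have ht : |t 0| ≤ ‖t‖ := by rw [← Real.norm_eq_abs]; exact norm_le_pi_norm t 0
    rw [one_mul]
    exact (circle_dist_smul_self_le (t 0) p).trans ht


/-! ### §2 Central frames are inherited by `ofLE`, products and powers; the whole vertical class -/

/-- Raising the step does not change central frames (same group, lattice and metric). [folklore] -/
theorem centralFrame_ofLE {s s' : ℕ} (X : Nilmanifold s) (hs : s ≤ s')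
    (hX : ∃ (I : Type) (_ : Fintype I) (ι : (I → ℝ) → (X).G) (L : ℝ), 0 < L ∧
      (∀ t u, ι (t + u) = ι t * ι u) ∧
      (∀ t, ι t ∈ Subgroup.center (X).G) ∧
      (∀ z ∈ Subgroup.center (X).G, ∃ t, ι t = z) ∧
      (∀ n : I → ℤ, ι (fun i => (n i : ℝ)) ∈ (X).Γ) ∧
      Continuous ι ∧
      (∀ (t : I → ℝ) (p q : (X).G ⧸ (X).Γ),
        (X).dist (ι t • p) (ι t • q) ≤ L * (X).dist p q) ∧
      (∀ (t : I → ℝ) (p : (X).G ⧸ (X).Γ), (X).dist (ι t • p) p ≤ L * ‖t‖)) :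
    ∃ (I : Type) (_ : Fintype I) (ι : (I → ℝ) → (X.ofLE hs).G) (L : ℝ), 0 < L ∧
      (∀ t u, ι (t + u) = ι t * ι u) ∧
      (∀ t, ι t ∈ Subgroup.center (X.ofLE hs).G) ∧
      (∀ z ∈ Subgroup.center (X.ofLE hs).G, ∃ t, ι t = z) ∧
      (∀ n : I → ℤ, ι (fun i => (n i : ℝ)) ∈ (X.ofLE hs).Γ) ∧
      Continuous ι ∧
      (∀ (t : I → ℝ) (p q : (X.ofLE hs).G ⧸ (X.ofLE hs).Γ),
        (X.ofLE hs).dist (ι t • p) (ι t • q) ≤ L * (X.ofLE hs).dist p q) ∧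
      (∀ (t : I → ℝ) (p : (X.ofLE hs).G ⧸ (X.ofLE hs).Γ), (X.ofLE hs).dist (ι t • p) p ≤ L * ‖t‖) :=
  hX

/-- The one-point nilmanifold has the empty central frame. [folklore] -/
theorem centralFrame_point (s : ℕ) :
    ∃ (I : Type) (_ : Fintype I) (ι : (I → ℝ) → (Nilmanifold.point s).G) (L : ℝ), 0 < L ∧
      (∀ t u, ι (t + u) = ι t * ι u) ∧
      (∀ t, ι t ∈ Subgroup.center (Nilmanifold.point s).G) ∧
      (∀ z ∈ Subgroup.center (Nilmanifold.point s).G, ∃ t, ι t = z) ∧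
      (∀ n : I → ℤ, ι (fun i => (n i : ℝ)) ∈ (Nilmanifold.point s).Γ) ∧
      Continuous ι ∧
      (∀ (t : I → ℝ) (p q : (Nilmanifold.point s).G ⧸ (Nilmanifold.point s).Γ),
        (Nilmanifold.point s).dist (ι t • p) (ι t • q) ≤ L * (Nilmanifold.point s).dist p q) ∧
      (∀ (t : I → ℝ) (p : (Nilmanifold.point s).G ⧸ (Nilmanifold.point s).Γ), (Nilmanifold.point s).dist (ι t • p) p ≤ L * ‖t‖) := by
  refine ⟨Fin 0, inferInstance, fun _ => 1, 1, one_pos, fun _ _ => (one_mul _).symm,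
    fun _ => Subgroup.one_mem _, fun z _ => ⟨fun _ => 0, ?_⟩, fun _ => Subgroup.mem_top _,
    continuous_const, fun t p q => ?_, fun t p => ?_⟩
  · exact (Units.ext (Subsingleton.elim (α := Fin 0 → ℝ) _ _)).symm
  · show (0 : ℝ) ≤ 1 * 0
    simp
  · show (0 : ℝ) ≤ 1 * ‖t‖
    positivity

/-- The action on a product nilmanifold is componentwise (read through
`(G × G')/(Γ × Γ') ≃ G/Γ × G'/Γ'`). [folklore] -/
theorem quotientProdMap_smul {s : ℕ} (X Y : Nilmanifold s) (g : (X.prod Y).G)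
    (p : (X.prod Y).G ⧸ (X.prod Y).Γ) :
    Nilmanifold.quotientProdMap X Y (g • p) =
      (Prod.fst g • (Nilmanifold.quotientProdMap X Y p).1,
        Prod.snd g • (Nilmanifold.quotientProdMap X Y p).2) := by
  obtain ⟨a, rfl⟩ := QuotientGroup.mk_surjective p
  rfl

/-- Restricting a vector `t : I ⊕ J → ℝ` to `I` does not increase the sup norm. [folklore] -/
theorem norm_comp_inl_le {I J : Type} [Fintype I] [Fintype J] (t : I ⊕ J → ℝ) :
    ‖(fun i => t (Sum.inl i))‖ ≤ ‖t‖ :=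
  (pi_norm_le_iff_of_nonneg (norm_nonneg t)).mpr fun i => norm_le_pi_norm t (Sum.inl i)

/-- Restricting a vector `t : I ⊕ J → ℝ` to `J` does not increase the sup norm. [folklore] -/
theorem norm_comp_inr_le {I J : Type} [Fintype I] [Fintype J] (t : I ⊕ J → ℝ) :
    ‖(fun j => t (Sum.inr j))‖ ≤ ‖t‖ :=
  (pi_norm_le_iff_of_nonneg (norm_nonneg t)).mpr fun j => norm_le_pi_norm t (Sum.inr j)

/-- **Products inherit central frames** (index set `I ⊕ J`, map `t ↦ (ι₁(t|I), ι₂(t|J))`, constant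
`max(L₁, L₂)`; the centre of a product is the product of the centres, the metric is the max
metric). [cite: GreenTao2012Mobius, Lemma 3.7] -/
theorem centralFrame_prod {s : ℕ} (X Y : Nilmanifold s)
    (hX : ∃ (I : Type) (_ : Fintype I) (ι : (I → ℝ) → (X).G) (L : ℝ), 0 < L ∧
      (∀ t u, ι (t + u) = ι t * ι u) ∧
      (∀ t, ι t ∈ Subgroup.center (X).G) ∧
      (∀ z ∈ Subgroup.center (X).G, ∃ t, ι t = z) ∧
      (∀ n : I → ℤ, ι (fun i => (n i : ℝ)) ∈ (X).Γ) ∧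
      Continuous ι ∧
      (∀ (t : I → ℝ) (p q : (X).G ⧸ (X).Γ),
        (X).dist (ι t • p) (ι t • q) ≤ L * (X).dist p q) ∧
      (∀ (t : I → ℝ) (p : (X).G ⧸ (X).Γ), (X).dist (ι t • p) p ≤ L * ‖t‖))
    (hY : ∃ (I : Type) (_ : Fintype I) (ι : (I → ℝ) → (Y).G) (L : ℝ), 0 < L ∧
      (∀ t u, ι (t + u) = ι t * ι u) ∧
      (∀ t, ι t ∈ Subgroup.center (Y).G) ∧
      (∀ z ∈ Subgroup.center (Y).G, ∃ t, ι t = z) ∧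
      (∀ n : I → ℤ, ι (fun i => (n i : ℝ)) ∈ (Y).Γ) ∧
      Continuous ι ∧
      (∀ (t : I → ℝ) (p q : (Y).G ⧸ (Y).Γ),
        (Y).dist (ι t • p) (ι t • q) ≤ L * (Y).dist p q) ∧
      (∀ (t : I → ℝ) (p : (Y).G ⧸ (Y).Γ), (Y).dist (ι t • p) p ≤ L * ‖t‖)) :
    ∃ (I : Type) (_ : Fintype I) (ι : (I → ℝ) → (X.prod Y).G) (L : ℝ), 0 < L ∧
      (∀ t u, ι (t + u) = ι t * ι u) ∧
      (∀ t, ι t ∈ Subgroup.center (X.prod Y).G) ∧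
      (∀ z ∈ Subgroup.center (X.prod Y).G, ∃ t, ι t = z) ∧
      (∀ n : I → ℤ, ι (fun i => (n i : ℝ)) ∈ (X.prod Y).Γ) ∧
      Continuous ι ∧
      (∀ (t : I → ℝ) (p q : (X.prod Y).G ⧸ (X.prod Y).Γ),
        (X.prod Y).dist (ι t • p) (ι t • q) ≤ L * (X.prod Y).dist p q) ∧
      (∀ (t : I → ℝ) (p : (X.prod Y).G ⧸ (X.prod Y).Γ), (X.prod Y).dist (ι t • p) p ≤ L * ‖t‖) := by
  obtain ⟨I, instI, ι₁, L₁, hL₁, hadd₁, hcen₁, hsurj₁, hΓ₁, hcont₁, hlip₁, hself₁⟩ := hX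
  obtain ⟨J, instJ, ι₂, L₂, hL₂, hadd₂, hcen₂, hsurj₂, hΓ₂, hcont₂, hlip₂, hself₂⟩ := hY
  refine ⟨I ⊕ J, inferInstance,
    fun t => ((ι₁ (fun i => t (Sum.inl i)), ι₂ (fun j => t (Sum.inr j))) : X.G × Y.G),
    max L₁ L₂, lt_max_of_lt_left hL₁, fun t u => ?_, fun t => ?_, fun z hz => ?_, fun n => ?_, ?_,
    fun t p q => ?_, fun t p => ?_⟩
  · -- homomorphism, componentwise
    change ((ι₁ ((fun i => t (Sum.inl i)) + fun i => u (Sum.inl i)),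
        ι₂ ((fun j => t (Sum.inr j)) + fun j => u (Sum.inr j))) : X.G × Y.G) =
      (ι₁ (fun i => t (Sum.inl i)) * ι₁ (fun i => u (Sum.inl i)),
        ι₂ (fun j => t (Sum.inr j)) * ι₂ (fun j => u (Sum.inr j)))
    rw [hadd₁, hadd₂]
  · -- central, componentwise
    rw [Subgroup.mem_center_iff]
    intro g
    exact Prod.ext (Subgroup.mem_center_iff.mp (hcen₁ _) (Prod.fst g))
      (Subgroup.mem_center_iff.mp (hcen₂ _) (Prod.snd g))
  · -- onto the centre: the centre of the product is the product of the centres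
    have hz1 : Prod.fst z ∈ Subgroup.center X.G := by
      rw [Subgroup.mem_center_iff]
      intro a
      have h := Subgroup.mem_center_iff.mp hz ((a, 1) : X.G × Y.G)
      exact congrArg Prod.fst h
    have hz2 : Prod.snd z ∈ Subgroup.center Y.G := by
      rw [Subgroup.mem_center_iff]
      intro b
      have h := Subgroup.mem_center_iff.mp hz ((1, b) : X.G × Y.G)
      exact congrArg Prod.snd h
    obtain ⟨t₁, ht₁⟩ := hsurj₁ _ hz1
    obtain ⟨t₂, ht₂⟩ := hsurj₂ _ hz2
    refine ⟨Sum.elim t₁ t₂, ?_⟩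
    change ((ι₁ (fun i => t₁ i), ι₂ (fun j => t₂ j)) : X.G × Y.G) = z
    exact Prod.ext ht₁ ht₂
  · -- integer points land in `Γ × Γ'`
    exact Subgroup.mem_prod.mpr ⟨hΓ₁ (fun i => n (Sum.inl i)), hΓ₂ (fun j => n (Sum.inr j))⟩
  · -- continuity
    exact Continuous.prodMk (hcont₁.comp (continuous_pi fun i => continuous_apply _))
      (hcont₂.comp (continuous_pi fun j => continuous_apply _))
  · -- uniform Lipschitz bound for the max metric
    rw [Nilmanifold.prod_dist_eq, Nilmanifold.prod_dist_eq, quotientProdMap_smul,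
      quotientProdMap_smul]
    set P := Nilmanifold.quotientProdMap X Y p
    set Q := Nilmanifold.quotientProdMap X Y q
    have hL0 : 0 ≤ max L₁ L₂ := (hL₁.le).trans (le_max_left _ _)
    have hd1 : 0 ≤ X.dist P.1 Q.1 := X.dist_nonneg _ _
    have hd2 : 0 ≤ Y.dist P.2 Q.2 := Y.dist_nonneg _ _
    refine max_le ?_ ?_
    · calc X.dist (ι₁ (fun i => t (Sum.inl i)) • P.1) (ι₁ (fun i => t (Sum.inl i)) • Q.1)
          ≤ L₁ * X.dist P.1 Q.1 := hlip₁ _ _ _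
        _ ≤ max L₁ L₂ * max (X.dist P.1 Q.1) (Y.dist P.2 Q.2) :=
            mul_le_mul (le_max_left _ _) (le_max_left _ _) hd1 hL0
    · calc Y.dist (ι₂ (fun j => t (Sum.inr j)) • P.2) (ι₂ (fun j => t (Sum.inr j)) • Q.2)
          ≤ L₂ * Y.dist P.2 Q.2 := hlip₂ _ _ _
        _ ≤ max L₁ L₂ * max (X.dist P.1 Q.1) (Y.dist P.2 Q.2) :=
            mul_le_mul (le_max_right _ _) (le_max_right _ _) hd2 hL0
  · -- translations move points little, for the max metric and the sup norm
    rw [Nilmanifold.prod_dist_eq, quotientProdMap_smul]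
    set P := Nilmanifold.quotientProdMap X Y p
    have hL0 : 0 ≤ max L₁ L₂ := (hL₁.le).trans (le_max_left _ _)
    refine max_le ?_ ?_
    · calc X.dist (ι₁ (fun i => t (Sum.inl i)) • P.1) P.1
          ≤ L₁ * ‖(fun i => t (Sum.inl i))‖ := hself₁ _ _
        _ ≤ max L₁ L₂ * ‖t‖ := mul_le_mul (le_max_left _ _) (norm_comp_inl_le t) (norm_nonneg _) hL0
    · calc Y.dist (ι₂ (fun j => t (Sum.inr j)) • P.2) P.2
          ≤ L₂ * ‖(fun j => t (Sum.inr j))‖ := hself₂ _ _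
        _ ≤ max L₁ L₂ * ‖t‖ := mul_le_mul (le_max_right _ _) (norm_comp_inr_le t) (norm_nonneg _) hL0

/-- **Powers inherit central frames** (`X^0` = point, `X^(m+1) = X × X^m`). [cite: GreenTao2012Mobius, Lemma 3.7] -/
theorem centralFrame_pow {s : ℕ} (X : Nilmanifold s)
    (hX : ∃ (I : Type) (_ : Fintype I) (ι : (I → ℝ) → (X).G) (L : ℝ), 0 < L ∧
      (∀ t u, ι (t + u) = ι t * ι u) ∧
      (∀ t, ι t ∈ Subgroup.center (X).G) ∧
      (∀ z ∈ Subgroup.center (X).G, ∃ t, ι t = z) ∧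
      (∀ n : I → ℤ, ι (fun i => (n i : ℝ)) ∈ (X).Γ) ∧
      Continuous ι ∧
      (∀ (t : I → ℝ) (p q : (X).G ⧸ (X).Γ),
        (X).dist (ι t • p) (ι t • q) ≤ L * (X).dist p q) ∧
      (∀ (t : I → ℝ) (p : (X).G ⧸ (X).Γ), (X).dist (ι t • p) p ≤ L * ‖t‖)) :
    ∀ m : ℕ, ∃ (I : Type) (_ : Fintype I) (ι : (I → ℝ) → (X.pow m).G) (L : ℝ), 0 < L ∧
      (∀ t u, ι (t + u) = ι t * ι u) ∧
      (∀ t, ι t ∈ Subgroup.center (X.pow m).G) ∧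
      (∀ z ∈ Subgroup.center (X.pow m).G, ∃ t, ι t = z) ∧
      (∀ n : I → ℤ, ι (fun i => (n i : ℝ)) ∈ (X.pow m).Γ) ∧
      Continuous ι ∧
      (∀ (t : I → ℝ) (p q : (X.pow m).G ⧸ (X.pow m).Γ),
        (X.pow m).dist (ι t • p) (ι t • q) ≤ L * (X.pow m).dist p q) ∧
      (∀ (t : I → ℝ) (p : (X.pow m).G ⧸ (X.pow m).Γ), (X.pow m).dist (ι t • p) p ≤ L * ‖t‖)
  | 0 => centralFrame_point s
  | m + 1 => centralFrame_prod X (X.pow m) hX (centralFrame_pow X hX m)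

/-- **Every member of the Heisenberg class `𝒞₂(H_d)` has a central frame** (induction over the
class: the Heisenberg generator, the circle, binary products). [cite: GreenTao2012Mobius, Lemma 3.7] -/
theorem centralFrame_of_inHeisClass (d : HX → HX → ℝ) (h : IsCompatMetric d)
    (hd : IsBoxComparable d) (X : Nilmanifold 2) (hX : InHeisClass (heisenbergWith d h) X) :
    ∃ (I : Type) (_ : Fintype I) (ι : (I → ℝ) → (X).G) (L : ℝ), 0 < L ∧
      (∀ t u, ι (t + u) = ι t * ι u) ∧
      (∀ t, ι t ∈ Subgroup.center (X).G) ∧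
      (∀ z ∈ Subgroup.center (X).G, ∃ t, ι t = z) ∧
      (∀ n : I → ℤ, ι (fun i => (n i : ℝ)) ∈ (X).Γ) ∧
      Continuous ι ∧
      (∀ (t : I → ℝ) (p q : (X).G ⧸ (X).Γ),
        (X).dist (ι t • p) (ι t • q) ≤ L * (X).dist p q) ∧
      (∀ (t : I → ℝ) (p : (X).G ⧸ (X).Γ), (X).dist (ι t • p) p ≤ L * ‖t‖) := by
  induction hX with
  | heis => exact centralFrame_heisenbergWith d h hd
  | circle => exact centralFrame_ofLE Nilmanifold.circle _ centralFrame_circle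
  | prod _ _ ihX ihY => exact centralFrame_prod _ _ ihX ihY

/-- **Central frames for the vertical class**: every `X^m × ℝ/ℤ` with `X ∈ 𝒞₂(H_d)` — the
nilmanifolds on which the `MNTwo` skeleton's `stub_mnVertical` / `stub_verticalReduction` are
stated (`circleTwo = Nilmanifold.circle.ofLE _`; the proof of `1 ≤ 2` is irrelevant) — has a
central frame. [cite: GreenTao2012Mobius, Lemma 3.7] -/
theorem centralFrame_verticalClass (d : HX → HX → ℝ) (h : IsCompatMetric d)
    (hd : IsBoxComparable d) (X : Nilmanifold 2) (hX : InHeisClass (heisenbergWith d h) X) (m : ℕ) :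
    ∃ (I : Type) (_ : Fintype I) (ι : (I → ℝ) → ((X.pow m).prod (Nilmanifold.circle.ofLE one_le_two)).G) (L : ℝ), 0 < L ∧
      (∀ t u, ι (t + u) = ι t * ι u) ∧
      (∀ t, ι t ∈ Subgroup.center ((X.pow m).prod (Nilmanifold.circle.ofLE one_le_two)).G) ∧
      (∀ z ∈ Subgroup.center ((X.pow m).prod (Nilmanifold.circle.ofLE one_le_two)).G, ∃ t, ι t = z) ∧
      (∀ n : I → ℤ, ι (fun i => (n i : ℝ)) ∈ ((X.pow m).prod (Nilmanifold.circle.ofLE one_le_two)).Γ) ∧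
      Continuous ι ∧
      (∀ (t : I → ℝ) (p q : ((X.pow m).prod (Nilmanifold.circle.ofLE one_le_two)).G ⧸ ((X.pow m).prod (Nilmanifold.circle.ofLE one_le_two)).Γ),
        ((X.pow m).prod (Nilmanifold.circle.ofLE one_le_two)).dist (ι t • p) (ι t • q) ≤ L * ((X.pow m).prod (Nilmanifold.circle.ofLE one_le_two)).dist p q) ∧
      (∀ (t : I → ℝ) (p : ((X.pow m).prod (Nilmanifold.circle.ofLE one_le_two)).G ⧸ ((X.pow m).prod (Nilmanifold.circle.ofLE one_le_two)).Γ), ((X.pow m).prod (Nilmanifold.circle.ofLE one_le_two)).dist (ι t • p) p ≤ L * ‖t‖) :=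
  centralFrame_prod _ _ (centralFrame_pow X (centralFrame_of_inHeisClass d h hd X hX) m)
    (centralFrame_ofLE Nilmanifold.circle _ centralFrame_circle)

end Summit.Parity.GeneralizedHardyLittlewood.GreenTaoLevelTwoMNTwoCentralFrames
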